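import Literature.Geometry.Riemannian.HeatEquationFamily
import Mathlib.Geometry.Manifold.SmoothApprox
import HarnessLib

/-!
# The heat propagation `(P_{s→t} φ)(x)` of a smooth family of metrics on a closed manifold,
# on smooth and on continuous data (Bamler 2020a, §2: the heat operator of a Ricci flow)

Continuation of `HeatEquationFamily.lean`. For a family `h(r)` of Riemannian metrics on a closed
manifold `M`, `C^∞` on `M × ℝ`, the **heat propagation** `P_{s→t}`, `s ≤ t`, sends a datum `φ` at
time `s` to the time-`t` slice of the solution of `∂ᵣ w = Δ_{h(r)} w` starting from `φ` (for a
Ricci flow: R. Bamler, *Entropy and heat kernel bounds on a Ricci flow background*,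
arXiv:2008.07093, §2, `u(x,t) = ∫ K(x,t;y,s) u(y,s) dg_s(y)`). Here:

* `heatValue h s t x φ` — `(P_{s→t}φ)(x)` for SMOOTH `φ` (the value of any smooth solution, well
  defined by uniqueness, `heatValue_eq`; junk value `φ x` for `t ≤ s`): linear, monotone,
  `P 1 = 1`, a sup-norm contraction, smooth in `x`, with the semigroup law
  `P_{s→t} = P_{r→t} ∘ P_{s→r}` (`heatValue_trans`);
* `smoothApprox I φ n` — smooth uniform `1/(n+1)`-approximants of a continuous function
  (`Continuous.exists_contMDiff_approx`, smooth partitions of unity);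
* `heatValueC h s t x φ` — `(P_{s→t}φ)(x)` for CONTINUOUS `φ`, the limit along the approximants
  (Cauchy by the contraction), computed by ANY uniformly convergent smooth sequence
  (`tendsto_heatValue_of_approx`), equal to `heatValue` on smooth data.

Linearity/positivity of `heatValueC` and the heat kernel measures are in `HeatKernelMeasures.lean`.
Everything is proved; no named facts.

## References

* R. H. Bamler, *Entropy and heat kernel bounds on a Ricci flow background*, arXiv:2008.07093
  (2020), §2. [Bamler2020Entropy]
* A. Friedman, *Partial differential equations of parabolic type*, Prentice-Hall 1964, Ch. 3,
  Thm. 7. [Friedman1964]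
* P. Topping, *Lectures on the Ricci flow*, CUP 2006, Thm. 3.1.1. [Topping2006]
-/

noncomputable section

open Bundle Set Function Filter Manifold MeasureTheory Measure TopologicalSpace
open scoped Manifold ContDiff Topology ENNReal

namespace Literature.Geometry.Riemannian

open Lorentzian Lorentzian.PseudoRiemannianMetric

/-! ### The heat propagation `(P_{s→t} φ)(x)` of smooth data -/

section HeatValue

variable {m : ℕ} {H : Type*} [TopologicalSpace H]
  {I : ModelWithCorners ℝ (EuclideanSpace ℝ (Fin m)) H} [I.Boundaryless]
  {M : Type*} [TopologicalSpace M] [ChartedSpace H M] [IsManifold I ∞ M]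
  [T2Space M] [CompactSpace M] [SecondCountableTopology M] [MeasurableSpace M] [BorelSpace M]
  {h : ℝ → PseudoRiemannianMetric I ∞ (EuclideanSpace ℝ (Fin m)) (TangentSpace I : M → Type _)}

open Classical in
/-- **The heat propagation `(P_{s→t} φ)(x)`** of the datum `φ` from time `s` to `(x, t)` along the
family `h`: the value `w t x` of a smooth solution of `∂ᵣ w = Δ_{h(r)} w` on `M × [s, t]` with
`w s = φ`, when `s < t` and such a solution exists (the value does not depend on the choice,
`heatValue_eq`); the junk value `φ x` otherwise (in particular for `t ≤ s`). For a Ricci flow this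
is the heat operator of Bamler 2020a, §2. [cite: Bamler2020Entropy, §2] -/
def heatValue
    (h : ℝ → PseudoRiemannianMetric I ∞ (EuclideanSpace ℝ (Fin m)) (TangentSpace I : M → Type _))
    (s t : ℝ) (x : M) (φ : M → ℝ) : ℝ :=
  if H : s < t ∧ ∃ w : ℝ → M → ℝ, IsHeatSolutionOn h w s t ∧ w s = φ then
    Classical.choose H.2 t x else φ x

omit [I.Boundaryless] [T2Space M] [CompactSpace M] [SecondCountableTopology M] [MeasurableSpace M]
  [BorelSpace M] in
/-- For `t ≤ s` the heat propagation is the junk value `φ x`. [folklore] -/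
theorem heatValue_of_le {s t : ℝ} (hts : t ≤ s) (x : M) (φ : M → ℝ) :
    heatValue h s t x φ = φ x := by
  unfold heatValue
  rw [dif_neg]
  exact fun H ↦ absurd H.1 (not_lt.2 hts)

variable (hh : IsContMDiffFamilyOn ∞ h univ) (hR : ∀ r, (h r).IsRiemannian)

omit [T2Space M] [SecondCountableTopology M] [MeasurableSpace M] [BorelSpace M] in
include hR in
/-- **The heat propagation is the value of ANY smooth solution** with the given datum
(uniqueness). [cite: Topping2006, Thm. 3.1.1 (p. 35)] -/
theorem heatValue_eq {w : ℝ → M → ℝ} {s t : ℝ} (hst : s < t) (hw : IsHeatSolutionOn h w s t)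
    {φ : M → ℝ} (h0 : w s = φ) (x : M) : heatValue h s t x φ = w t x := by
  have H : s < t ∧ ∃ w : ℝ → M → ℝ, IsHeatSolutionOn h w s t ∧ w s = φ := ⟨hst, w, hw, h0⟩
  unfold heatValue
  rw [dif_pos H]
  have hspec := Classical.choose_spec H.2
  exact hspec.1.unique hR hst hw (hspec.2.trans h0.symm) ⟨hst.le, le_rfl⟩ x

include hh hR in
/-- For smooth data and `s < t` the heat propagation is realised by a smooth solution.
[cite: Friedman1964, Ch. 3, Thm. 7] -/
theorem exists_isHeatSolutionOn_heatValue {s t : ℝ} (hst : s < t) {φ : M → ℝ}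
    (hφ : ContMDiff I 𝓘(ℝ, ℝ) ∞ φ) :
    ∃ w : ℝ → M → ℝ, IsHeatSolutionOn h w s t ∧ w s = φ ∧
      ∀ r ∈ Icc s t, ∀ x, heatValue h s r x φ = w r x := by
  obtain ⟨w, hw, h0⟩ := exists_isHeatSolutionOn hh hR hst hφ
  refine ⟨w, hw, h0, fun r hr x ↦ ?_⟩
  rcases eq_or_lt_of_le hr.1 with hsr | hsr
  · subst hsr
    rw [heatValue_of_le le_rfl, h0]
  · exact heatValue_eq hR hsr (hw.mono le_rfl hr.2) h0 x

include hh hR in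
/-- **Linearity** of the heat propagation on smooth data: additivity. [folklore] -/
theorem heatValue_add {s t : ℝ} (x : M) {φ ψ : M → ℝ} (hφ : ContMDiff I 𝓘(ℝ, ℝ) ∞ φ)
    (hψ : ContMDiff I 𝓘(ℝ, ℝ) ∞ ψ) :
    heatValue h s t x (fun y ↦ φ y + ψ y) = heatValue h s t x φ + heatValue h s t x ψ := by
  rcases le_or_gt t s with hts | hst
  · simp only [heatValue_of_le hts]
  obtain ⟨w₁, hw₁, h₁, hv₁⟩ := exists_isHeatSolutionOn_heatValue hh hR hst hφ
  obtain ⟨w₂, hw₂, h₂, hv₂⟩ := exists_isHeatSolutionOn_heatValue hh hR hst hψ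
  rw [hv₁ t ⟨hst.le, le_rfl⟩ x, hv₂ t ⟨hst.le, le_rfl⟩ x]
  exact heatValue_eq hR hst (hw₁.add hw₂) (by funext y; simp [h₁, h₂]) x

include hh hR in
/-- **Linearity** of the heat propagation on smooth data: homogeneity. [folklore] -/
theorem heatValue_const_mul {s t : ℝ} (x : M) (c : ℝ) {φ : M → ℝ}
    (hφ : ContMDiff I 𝓘(ℝ, ℝ) ∞ φ) :
    heatValue h s t x (fun y ↦ c * φ y) = c * heatValue h s t x φ := by
  rcases le_or_gt t s with hts | hst
  · simp only [heatValue_of_le hts]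
  obtain ⟨w, hw, h0, hv⟩ := exists_isHeatSolutionOn_heatValue hh hR hst hφ
  rw [hv t ⟨hst.le, le_rfl⟩ x]
  exact heatValue_eq hR hst (hw.const_mul c) (by funext y; simp [h0]) x

omit [T2Space M] [SecondCountableTopology M] [MeasurableSpace M] [BorelSpace M] in
include hR in
/-- **Constants are propagated to themselves**: `P_{s→t} c = c` (conservation of total heat
kernel mass). [folklore] -/
theorem heatValue_const {s t : ℝ} (x : M) (c : ℝ) : heatValue h s t x (fun _ ↦ c) = c := by
  rcases le_or_gt t s with hts | hst
  · simp only [heatValue_of_le hts]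
  exact heatValue_eq hR hst (isHeatSolutionOn_const c s t) rfl x

include hh hR in
/-- **Sup-norm contraction** of the heat propagation on smooth data:
`|P φ − P ψ| ≤ sup |φ − ψ|`. [cite: Topping2006, Thm. 3.1.1 (p. 35)] -/
theorem abs_heatValue_sub_le {s t : ℝ} (x : M) {φ ψ : M → ℝ} (hφ : ContMDiff I 𝓘(ℝ, ℝ) ∞ φ)
    (hψ : ContMDiff I 𝓘(ℝ, ℝ) ∞ ψ) {A : ℝ} (hA : ∀ y, |φ y - ψ y| ≤ A) :
    |heatValue h s t x φ - heatValue h s t x ψ| ≤ A := by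
  rcases le_or_gt t s with hts | hst
  · simpa only [heatValue_of_le hts] using hA x
  obtain ⟨w₁, hw₁, h₁, hv₁⟩ := exists_isHeatSolutionOn_heatValue hh hR hst hφ
  obtain ⟨w₂, hw₂, h₂, hv₂⟩ := exists_isHeatSolutionOn_heatValue hh hR hst hψ
  rw [hv₁ t ⟨hst.le, le_rfl⟩ x, hv₂ t ⟨hst.le, le_rfl⟩ x]
  exact hw₁.abs_sub_le hR hst hw₂ (fun y ↦ by rw [h₁, h₂]; exact hA y) ⟨hst.le, le_rfl⟩ x

include hh hR in
/-- **Positivity / monotonicity** of the heat propagation on smooth data. [folklore] -/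
theorem heatValue_mono {s t : ℝ} (x : M) {φ ψ : M → ℝ} (hφ : ContMDiff I 𝓘(ℝ, ℝ) ∞ φ)
    (hψ : ContMDiff I 𝓘(ℝ, ℝ) ∞ ψ) (hle : ∀ y, φ y ≤ ψ y) :
    heatValue h s t x φ ≤ heatValue h s t x ψ := by
  rcases le_or_gt t s with hts | hst
  · simpa only [heatValue_of_le hts] using hle x
  obtain ⟨w₁, hw₁, h₁, hv₁⟩ := exists_isHeatSolutionOn_heatValue hh hR hst hφ
  obtain ⟨w₂, hw₂, h₂, hv₂⟩ := exists_isHeatSolutionOn_heatValue hh hR hst hψ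
  rw [hv₁ t ⟨hst.le, le_rfl⟩ x, hv₂ t ⟨hst.le, le_rfl⟩ x]
  exact hw₁.le_of_le_initial hR hst hw₂ (fun y ↦ by rw [h₁, h₂]; exact hle y) ⟨hst.le, le_rfl⟩ x

include hh hR in
/-- The heat propagation of smooth data is smooth in the space variable. [folklore] -/
theorem contMDiff_heatValue {s t : ℝ} {φ : M → ℝ} (hφ : ContMDiff I 𝓘(ℝ, ℝ) ∞ φ) :
    ContMDiff I 𝓘(ℝ, ℝ) ∞ (fun x ↦ heatValue h s t x φ) := by
  rcases le_or_gt t s with hts | hst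
  · simp only [heatValue_of_le hts]; exact hφ
  obtain ⟨w, hw, -, hv⟩ := exists_isHeatSolutionOn_heatValue hh hR hst hφ
  have e : (fun x ↦ heatValue h s t x φ) = w t := funext fun x ↦ hv t ⟨hst.le, le_rfl⟩ x
  rw [e]
  exact hw.contMDiff_slice ⟨hst.le, le_rfl⟩

include hh hR in
/-- **Semigroup property** of the heat propagation on smooth data: `P_{s→t} = P_{r→t} ∘ P_{s→r}`
for `s ≤ r ≤ t` (uniqueness of solutions; Bamler 2020a §2, the reproduction formula).
[cite: Bamler2020Entropy, §2] -/
theorem heatValue_trans {s r t : ℝ} (hsr : s ≤ r) (hrt : r ≤ t) (x : M) {φ : M → ℝ}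
    (hφ : ContMDiff I 𝓘(ℝ, ℝ) ∞ φ) :
    heatValue h s t x φ = heatValue h r t x (fun y ↦ heatValue h s r y φ) := by
  rcases eq_or_lt_of_le hrt with hrt' | hrt'
  · subst hrt'
    rw [heatValue_of_le le_rfl]
  rcases eq_or_lt_of_le hsr with hsr' | hsr'
  · subst hsr'
    simp only [heatValue_of_le le_rfl]
  obtain ⟨w, hw, h0, hv⟩ := exists_isHeatSolutionOn_heatValue hh hR (hsr'.trans hrt') hφ
  rw [hv t ⟨(hsr'.trans hrt').le, le_rfl⟩ x]
  have e : (fun y ↦ heatValue h s r y φ) = w r := funext fun y ↦ hv r ⟨hsr'.le, hrt'.le⟩ y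
  rw [e]
  exact (heatValue_eq hR hrt' (hw.mono hsr'.le le_rfl) rfl x).symm

end HeatValue

/-! ### Extension to continuous data -/

section Continuous

open CompactlySupported CompactlySupportedContinuousMap

variable {m : ℕ} {H : Type*} [TopologicalSpace H]
  {I : ModelWithCorners ℝ (EuclideanSpace ℝ (Fin m)) H} [I.Boundaryless]
  {M : Type*} [TopologicalSpace M] [ChartedSpace H M] [IsManifold I ∞ M]
  [T2Space M] [CompactSpace M] [SecondCountableTopology M] [MeasurableSpace M] [BorelSpace M]
  {h : ℝ → PseudoRiemannianMetric I ∞ (EuclideanSpace ℝ (Fin m)) (TangentSpace I : M → Type _)}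

variable (I) in
omit [I.Boundaryless] [SecondCountableTopology M] [MeasurableSpace M] [BorelSpace M] in
/-- **Smooth functions are uniformly dense in `C(M)`** on a compact manifold
(`Continuous.exists_contMDiff_approx`, from smooth partitions of unity). [folklore] -/
theorem exists_contMDiff_abs_sub_lt {φ : M → ℝ} (hφ : Continuous φ) {ε : ℝ} (hε : 0 < ε) :
    ∃ ψ : M → ℝ, ContMDiff I 𝓘(ℝ, ℝ) ∞ ψ ∧ ∀ y, |ψ y - φ y| < ε := by
  obtain ⟨g, hg, -⟩ := hφ.exists_contMDiff_approx I ⊤ continuous_const (fun _ ↦ hε)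
  exact ⟨g, g.contMDiff, fun y ↦ by simpa [Real.dist_eq] using hg y⟩

variable (I) in
open Classical in
/-- The `n`-th smooth uniform approximant of a function on `M`, within `1/(n+1)` when the function
is continuous (the function itself otherwise). [folklore] -/
def smoothApprox (φ : M → ℝ) (n : ℕ) : M → ℝ :=
  if hφ : Continuous φ then
    Classical.choose (exists_contMDiff_abs_sub_lt I hφ (Nat.one_div_pos_of_nat (n := n)))
  else φ

omit [I.Boundaryless] [SecondCountableTopology M] [MeasurableSpace M] [BorelSpace M] in
/-- The smooth approximants are smooth. [folklore] -/
theorem contMDiff_smoothApprox {φ : M → ℝ} (hφ : Continuous φ) (n : ℕ) :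
    ContMDiff I 𝓘(ℝ, ℝ) ∞ (smoothApprox I φ n) := by
  unfold smoothApprox
  rw [dif_pos hφ]
  exact (Classical.choose_spec (exists_contMDiff_abs_sub_lt I hφ
    (Nat.one_div_pos_of_nat (n := n)))).1

omit [I.Boundaryless] [SecondCountableTopology M] [MeasurableSpace M] [BorelSpace M] in
/-- The `n`-th smooth approximant is uniformly within `1/(n+1)`. [folklore] -/
theorem abs_smoothApprox_sub_lt {φ : M → ℝ} (hφ : Continuous φ) (n : ℕ) (y : M) :
    |smoothApprox I φ n y - φ y| < 1 / ((n : ℝ) + 1) := by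
  unfold smoothApprox
  rw [dif_pos hφ]
  exact (Classical.choose_spec (exists_contMDiff_abs_sub_lt I hφ
    (Nat.one_div_pos_of_nat (n := n)))).2 y

/-- **The heat propagation `(P_{s→t} φ)(x)` of a continuous datum**: the limit of the heat
propagations of its smooth uniform approximants (it is the value at `(x, t)` of the unique
solution, smooth for `r > s`, of the heat equation with continuous initial datum `φ` at time `s`;
Bamler 2020a, §2). [cite: Bamler2020Entropy, §2] -/
def heatValueC
    (h : ℝ → PseudoRiemannianMetric I ∞ (EuclideanSpace ℝ (Fin m)) (TangentSpace I : M → Type _))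
    (s t : ℝ) (x : M) (φ : M → ℝ) : ℝ :=
  limUnder atTop fun n ↦ heatValue h s t x (smoothApprox I φ n)

variable (hh : IsContMDiffFamilyOn ∞ h univ) (hR : ∀ r, (h r).IsRiemannian)

include hh hR in
/-- The heat propagations of the smooth approximants converge to `heatValueC` (they form a Cauchy
sequence by the sup-norm contraction). [folklore] -/
theorem tendsto_heatValue_smoothApprox (s t : ℝ) (x : M) {φ : M → ℝ} (hφ : Continuous φ) :
    Tendsto (fun n ↦ heatValue h s t x (smoothApprox I φ n)) atTop (𝓝 (heatValueC h s t x φ)) := by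
  refine tendsto_nhds_limUnder (cauchySeq_tendsto_of_complete ?_)
  refine cauchySeq_of_le_tendsto_0 (fun N : ℕ ↦ 2 * (1 / ((N : ℝ) + 1))) (fun n k N hn hk ↦ ?_) ?_
  · rw [Real.dist_eq]
    have hb : ∀ y, |smoothApprox I φ n y - smoothApprox I φ k y| ≤
        1 / ((n : ℝ) + 1) + 1 / ((k : ℝ) + 1) := fun y ↦ by
      have h1 := abs_smoothApprox_sub_lt (I := I) hφ n y
      have h2 := abs_smoothApprox_sub_lt (I := I) hφ k y
      rw [abs_sub_comm] at h2
      have := abs_sub_le (smoothApprox I φ n y) (φ y) (smoothApprox I φ k y)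
      linarith
    have hle := abs_heatValue_sub_le hh hR (s := s) (t := t) x (contMDiff_smoothApprox hφ n)
      (contMDiff_smoothApprox hφ k) hb
    have hn' : 1 / ((n : ℝ) + 1) ≤ 1 / ((N : ℝ) + 1) :=
      one_div_le_one_div_of_le (by positivity) (by exact_mod_cast Nat.add_le_add_right hn 1)
    have hk' : 1 / ((k : ℝ) + 1) ≤ 1 / ((N : ℝ) + 1) :=
      one_div_le_one_div_of_le (by positivity) (by exact_mod_cast Nat.add_le_add_right hk 1)
    linarith
  · simpa using ((tendsto_one_div_add_atTop_nhds_zero_nat (𝕜 := ℝ)).const_mul (2 : ℝ))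

include hh hR in
/-- **Every uniformly convergent sequence of smooth approximants computes `heatValueC`.**
[folklore] -/
theorem tendsto_heatValue_of_approx (s t : ℝ) (x : M) {φ : M → ℝ} (hφ : Continuous φ)
    {ψ : ℕ → M → ℝ} (hψ : ∀ n, ContMDiff I 𝓘(ℝ, ℝ) ∞ (ψ n)) {ε : ℕ → ℝ}
    (hε : Tendsto ε atTop (𝓝 0)) (hclose : ∀ n y, |ψ n y - φ y| ≤ ε n) :
    Tendsto (fun n ↦ heatValue h s t x (ψ n)) atTop (𝓝 (heatValueC h s t x φ)) := by
  have h1 := tendsto_heatValue_smoothApprox hh hR s t x hφ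
  have h2 : Tendsto (fun n ↦ heatValue h s t x (ψ n) - heatValue h s t x (smoothApprox I φ n))
      atTop (𝓝 0) := by
    refine squeeze_zero_norm (a := fun n ↦ ε n + 1 / ((n : ℝ) + 1)) (fun n ↦ ?_) ?_
    · rw [Real.norm_eq_abs]
      refine abs_heatValue_sub_le hh hR x (hψ n) (contMDiff_smoothApprox hφ n) fun y ↦ ?_
      have ha := hclose n y
      have hb := abs_smoothApprox_sub_lt (I := I) hφ n y
      rw [abs_sub_comm] at hb
      have := abs_sub_le (ψ n y) (φ y) (smoothApprox I φ n y)
      linarith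
    · simpa using hε.add (tendsto_one_div_add_atTop_nhds_zero_nat (𝕜 := ℝ))
  have h3 := h1.add h2
  simp only [add_zero] at h3
  exact h3.congr fun n ↦ by ring

include hh hR in
/-- Quantitative closeness: a smooth `ψ` uniformly within `A` of the continuous `φ` has heat
propagation within `A` of `heatValueC φ`. [folklore] -/
theorem abs_heatValue_sub_heatValueC_le {s t : ℝ} (x : M) {φ ψ : M → ℝ} (hφ : Continuous φ)
    (hψ : ContMDiff I 𝓘(ℝ, ℝ) ∞ ψ) {A : ℝ} (hA : ∀ y, |ψ y - φ y| ≤ A) :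
    |heatValue h s t x ψ - heatValueC h s t x φ| ≤ A := by
  have h1 := tendsto_heatValue_smoothApprox hh hR s t x hφ
  have hlim : Tendsto (fun n ↦ |heatValue h s t x ψ - heatValue h s t x (smoothApprox I φ n)|)
      atTop (𝓝 |heatValue h s t x ψ - heatValueC h s t x φ|) :=
    (tendsto_const_nhds.sub h1).abs
  have hbound : Tendsto (fun n : ℕ ↦ A + 1 / ((n : ℝ) + 1)) atTop (𝓝 A) := by
    simpa using (tendsto_const_nhds (x := A)).add (tendsto_one_div_add_atTop_nhds_zero_nat (𝕜 := ℝ))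
  refine le_of_tendsto_of_tendsto' hlim hbound fun n ↦ ?_
  refine abs_heatValue_sub_le hh hR x hψ (contMDiff_smoothApprox hφ n) fun y ↦ ?_
  have ha := hA y
  have hb := abs_smoothApprox_sub_lt (I := I) hφ n y
  rw [abs_sub_comm] at hb
  have := abs_sub_le (ψ y) (φ y) (smoothApprox I φ n y)
  linarith

include hh hR in
/-- On smooth data `heatValueC` is `heatValue`. [folklore] -/
theorem heatValueC_eq_heatValue {s t : ℝ} (x : M) {φ : M → ℝ} (hφ : ContMDiff I 𝓘(ℝ, ℝ) ∞ φ) :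
    heatValueC h s t x φ = heatValue h s t x φ := by
  have h1 := tendsto_heatValue_of_approx hh hR s t x hφ.continuous (ψ := fun _ ↦ φ)
    (fun _ ↦ hφ) (ε := fun _ ↦ 0) tendsto_const_nhds (fun n y ↦ by simp)
  exact (tendsto_nhds_unique h1 tendsto_const_nhds)

omit [I.Boundaryless] [IsManifold I ∞ M] [T2Space M] [CompactSpace M] [SecondCountableTopology M]
  [MeasurableSpace M] [BorelSpace M] [TopologicalSpace H] [TopologicalSpace M] [ChartedSpace H M] in
/-- `1/(n+1) + 1/(n+1) → 0`. [folklore] -/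
private theorem tendsto_one_div_add_one_div :
    Tendsto (fun n : ℕ ↦ 1 / ((n : ℝ) + 1) + 1 / ((n : ℝ) + 1)) atTop (𝓝 0) := by
  have := (tendsto_one_div_add_atTop_nhds_zero_nat (𝕜 := ℝ)).add
    (tendsto_one_div_add_atTop_nhds_zero_nat (𝕜 := ℝ))
  rwa [add_zero] at this

include hh hR in
/-- **Additivity** of the heat propagation on continuous data. [folklore] -/
theorem heatValueC_add {s t : ℝ} (x : M) {φ φ' : M → ℝ} (hφ : Continuous φ) (hφ' : Continuous φ') :
    heatValueC h s t x (fun y ↦ φ y + φ' y) = heatValueC h s t x φ + heatValueC h s t x φ' := by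
  have hsum : Continuous fun y ↦ φ y + φ' y := hφ.add hφ'
  have h1 := tendsto_heatValue_of_approx hh hR s t x hsum
    (ψ := fun n y ↦ smoothApprox I φ n y + smoothApprox I φ' n y)
    (fun n ↦ (contMDiff_smoothApprox hφ n).add (contMDiff_smoothApprox hφ' n))
    (ε := fun n ↦ 1 / ((n : ℝ) + 1) + 1 / ((n : ℝ) + 1))
    tendsto_one_div_add_one_div
    (fun n y ↦ by
      have ha := abs_smoothApprox_sub_lt (I := I) hφ n y
      have hb := abs_smoothApprox_sub_lt (I := I) hφ' n y
      have := abs_add_le (smoothApprox I φ n y - φ y) (smoothApprox I φ' n y - φ' y)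
      have e : smoothApprox I φ n y + smoothApprox I φ' n y - (φ y + φ' y) =
          smoothApprox I φ n y - φ y + (smoothApprox I φ' n y - φ' y) := by ring
      rw [e]; linarith)
  have h2 := (tendsto_heatValue_smoothApprox hh hR s t x hφ).add
    (tendsto_heatValue_smoothApprox hh hR s t x hφ')
  refine tendsto_nhds_unique h1 (h2.congr fun n ↦ ?_)
  exact (heatValue_add hh hR x (contMDiff_smoothApprox hφ n) (contMDiff_smoothApprox hφ' n)).symm

include hh hR in
/-- **Homogeneity** of the heat propagation on continuous data. [folklore] -/
theorem heatValueC_const_mul {s t : ℝ} (x : M) (c : ℝ) {φ : M → ℝ} (hφ : Continuous φ) :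
    heatValueC h s t x (fun y ↦ c * φ y) = c * heatValueC h s t x φ := by
  have hsm : Continuous fun y ↦ c * φ y := continuous_const.mul hφ
  have h1 := tendsto_heatValue_of_approx hh hR s t x hsm
    (ψ := fun n y ↦ c * smoothApprox I φ n y)
    (fun n ↦ contMDiff_const.mul (contMDiff_smoothApprox hφ n))
    (ε := fun n ↦ |c| * (1 / ((n : ℝ) + 1)))
    (by simpa using (tendsto_one_div_add_atTop_nhds_zero_nat (𝕜 := ℝ)).const_mul |c|)
    (fun n y ↦ by
      rw [← mul_sub, abs_mul]
      exact mul_le_mul_of_nonneg_left (abs_smoothApprox_sub_lt (I := I) hφ n y).le (abs_nonneg c))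
  have h2 := (tendsto_heatValue_smoothApprox hh hR s t x hφ).const_mul c
  refine tendsto_nhds_unique h1 (h2.congr fun n ↦ ?_)
  exact (heatValue_const_mul hh hR x c (contMDiff_smoothApprox hφ n)).symm

end Continuous

end Literature.Geometry.Riemannian

end
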